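import Literature.NumberTheory.GaloisRepresentations.ContinuousCorestriction
import Literature.NumberTheory.GaloisRepresentations.ContinuousCohomologyConnecting
import HarnessLib

/-!
# Corestriction on continuous `H¹`: naturality in the coefficients and the double-coset (Mackey)
# formula `res_D ∘ cor_{G/N} = Σ cor_{D/D∩N} ∘ res ∘ conj` — TOOL file 1 of row T-DER-BN
# (cell `b2b-bsdres`, team n1011, seat p15 GEN 6; skeleton `cells/n1011/skel/T-DER-BN.md`)

HONEST FRAMING (cell `b2b-bsdres`, run/shared/lean/b2b/bsd-rank1-residual/, verbatim in every
file): the goal of the cell is to DELETE the COMBINATION-SHAPED residual classes of the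
Birch–Swinnerton-Dyer formula for ALL analytic-rank `≤ 1` elliptic curves over `ℚ` — "full BSD
formula for every rank `≤ 1` curve in class `C`" assembled STRICTLY from published theorems — so
that the rank-`≤ 1` remainder becomes exactly the CONSTRUCTION-SHAPED classes, which are TYPED
(missing-input `Prop`s), NOT attempted. This is not "finishing BSD". Team n1011 (N10 / N11, the
additive block X4 ∧ `p = 3`): research route on the CONSTRUCTION-SHAPED class X4; no claim beyond the
stated classes; nothing is booked. TOOL theorems of continuous group cohomology (no definition, no
named fact, no `sorry`); group-free, ring-free, curve-free.

## What

For a topological representation `X` of a topological group `G` and an open subgroup `N` of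
finite index, the tree's corestriction `cores X N : H¹(N, X) → H¹(G, X)`
(`ContinuousCorestriction`, explicit transfer on crossed homomorphisms) satisfies:

* §1 **naturality in the coefficients**: for an equivariant `f : X ⟶ Y`,
  `H¹(f) ∘ cor = cor ∘ H¹(f|_N)` (`cohomologyMap_cores`; on cocycles the transfer of `f ∘ φ` is
  `f ∘` the transfer of `φ`), and the same for the relative corestriction `coresLe` and for the
  tautological comparison `toSubgroupOf`;
* §2 **the one-term double-coset formula**: for subgroups `D`, `D′` with `D′ ≤ D`, `D′ ≤ N`,
  `D ∩ N ≤ D′` (so `D′ = D ∩ N`) and `D · N = G`,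
  `res_D (cor_{G/N} y) = cor_{D/D′} (res_{N/D′} y)` (`resSubgroup_cores_eq_cores_of_forall_exists`):
  the transfer computed with coset representatives chosen in `D` IS the transfer of `D` along
  `D′`;
* §3 **the double-coset (Mackey) formula for a normal `N`**: for any subgroup `D` (closed or not),
  `res_D (cor_{G/N} y) = Σ_{q ∈ G/(D·N)} cor_{D/D′} (res_{N/D′} ((t_q)⁻¹ · y))`
  (`resSubgroup_cores_eq_sum_cores`), where `t_q` are representatives of `G ⧸ (D ⊔ N)` and
  `g · y` is the tree's `conjMap` (`(g·φ)(n) = g φ(g⁻¹ n g)`): the `D`-orbits on `G/N` are the sets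
  `D · (t_q)⁻¹ N / N ≅ D/D′`, and on each orbit the transfer with adapted representatives
  `u(δ) (t_q)⁻¹` is the transfer of `D` along `D′` applied to the conjugated cocycle.
  The tree's `ConjugationDescent.resSubgroup_cores_eq_sum` (`res_N ∘ cor = Σ_{G/N} conj`) is the
  case `D = N`.

Used by row T-DER-BN (skeleton §1 (S2): `G = Γ_K`, `N = Gal(K̄/K_i)`, `D = Gal(K̄/K(r))`, one term,
norm-compatibility of Kolyvagin's derivative classes; (S4): `D` a decomposition group).
References: J. Neukirch, A. Schmidt, K. Wingberg, *Cohomology of Number Fields* (2008), I §5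
(cor/res on inhomogeneous cochains, (1.5.6) double cosets); K. S. Brown, *Cohomology of Groups*
(1982), III (9.5) (ii) (Mackey formula); J.-P. Serre, *Local Fields* (1979), VII §7–§8.
-/

noncomputable section

open CategoryTheory Function Finset

universe u v

namespace Summit.BirchSwinnertonDyer.Rank1Residual.GaloisImage

namespace Derivative

namespace Mackey

open Literature.NumberTheory.GaloisRepresentations
open Literature.NumberTheory.EllipticCurves (schreierElt schreierElt_mem schreierElt_coe
  subgroupInclusion subgroupInclusion_apply_coe subgroupConj subgroupConj_apply_coe
  conj_mem_of_normal)

variable {R : Type u} [CommRing R] [TopologicalSpace R]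
variable {G : Type v} [Group G] [TopologicalSpace G] [IsTopologicalGroup G]

/-! ### §1 Naturality of the corestriction in the coefficients -/

section Coeff

variable {X Y : TopRep.{v} R G} (f : X ⟶ Y) (N : Subgroup G) [Fintype (G ⧸ N)]

omit [IsTopologicalGroup G] in
/-- On cocycles: the transfer of `f ∘ φ` is `f ∘ (transfer of φ)` (`f` is `G`-equivariant and
additive). [folklore] -/
theorem transferFun_pullback {s : G ⧸ N → G} (hs : ∀ x : G ⧸ N, (s x : G ⧸ N) = x)
    (φ : contOneCocycles (subgroupRep X N)) (g : G) :
    transferFun Y N hs (contOneCocycles.pullback (ContinuousMonoidHom.id N)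
        (X := subgroupRep X N) (Y := subgroupRep Y N) ((TopRep.resFunctor N.subtype).map f) φ) g =
      f.hom (transferFun X N hs φ g) := by
  rw [transferFun_apply, transferFun_apply, map_sum]
  refine Finset.sum_congr rfl fun x _ => ?_
  rw [contOneCocycles.pullback_apply]
  change Y.ρ (s (g • x)) (f.hom (φ.1 (schreierElt N hs g x))) = _
  rw [TopRep.hom_comm_apply]

/-- **`H¹(f) ∘ cor = cor ∘ H¹(f|_N)`**: the corestriction `H¹(N, X) → H¹(G, X)` is natural in the
coefficient representation `X` (NSW (2008) I §5, functoriality of cor). [folklore] -/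
theorem cohomologyMap_cores (hN : IsOpen (N : Set G)) (y : continuousCohomology 1 (subgroupRep X N)) :
    cohomologyMap f 1 (cores X N hN y) =
      cores Y N hN (ContinuousCohomology.map (ContinuousMonoidHom.id N) (X := subgroupRep X N)
        (Y := subgroupRep Y N) ((TopRep.resFunctor N.subtype).map f) 1 y) := by
  obtain ⟨φ, rfl⟩ := oneCocycleClass_surjective _ y
  rw [cores_oneCocycleClass X N hN QuotientGroup.out_eq', cohomologyMap_oneCocycleClass,
    map_oneCocycleClass, cores_oneCocycleClass Y N hN QuotientGroup.out_eq']
  refine congrArg _ (Subtype.ext (ContinuousMap.ext fun g => ?_))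
  rw [pullback_id_resIdHom_apply, transferCocycle_apply, transferCocycle_apply,
    transferFun_pullback]

variable {N} in
/-- The tautological comparison `toSubgroupOf : H¹(H, X) → H¹(H.subgroupOf H′, X|H′)` is natural
in the coefficients. [folklore] -/
theorem map_toSubgroupOf {H H' : Subgroup G} (h : H ≤ H')
    (y : continuousCohomology 1 (subgroupRep X H)) :
    ContinuousCohomology.map (ContinuousMonoidHom.id (H.subgroupOf H'))
        (X := subgroupRep (subgroupRep X H') (H.subgroupOf H'))
        (Y := subgroupRep (subgroupRep Y H') (H.subgroupOf H'))
        ((TopRep.resFunctor (H.subgroupOf H').subtype).map ((TopRep.resFunctor H'.subtype).map f)) 1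
        (toSubgroupOf X h 1 y) =
      toSubgroupOf Y h 1 (ContinuousCohomology.map (ContinuousMonoidHom.id H)
        (X := subgroupRep X H) (Y := subgroupRep Y H) ((TopRep.resFunctor H.subtype).map f) 1 y) := by
  obtain ⟨φ, rfl⟩ := oneCocycleClass_surjective _ y
  rw [toSubgroupOf, toSubgroupOf, map_oneCocycleClass, map_oneCocycleClass, map_oneCocycleClass,
    map_oneCocycleClass]
  exact congrArg _ (Subtype.ext (ContinuousMap.ext fun _ => rfl))

variable {N} in
/-- **`H¹(f|_{H′}) ∘ cor_{H′/H} = cor_{H′/H} ∘ H¹(f|_H)`**: the relative corestriction `coresLe`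
(through which the Euler-system norm relations are stated) is natural in the coefficients.
[folklore] -/
theorem map_coresLe {H H' : Subgroup G} (h : H ≤ H') (hH : IsOpen (H : Set G))
    [Fintype (H' ⧸ H.subgroupOf H')] (y : continuousCohomology 1 (subgroupRep X H)) :
    ContinuousCohomology.map (ContinuousMonoidHom.id H') (X := subgroupRep X H')
        (Y := subgroupRep Y H') ((TopRep.resFunctor H'.subtype).map f) 1 (coresLe X h hH y) =
      coresLe Y h hH (ContinuousCohomology.map (ContinuousMonoidHom.id H)
        (X := subgroupRep X H) (Y := subgroupRep Y H) ((TopRep.resFunctor H.subtype).map f) 1 y) := by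
  obtain ⟨φ, rfl⟩ := oneCocycleClass_surjective _ y
  have hs : ∀ x : H' ⧸ H.subgroupOf H', ((Quotient.out x : H') : H' ⧸ H.subgroupOf H') = x :=
    QuotientGroup.out_eq'
  rw [coresLe_oneCocycleClass X h hH hs, map_oneCocycleClass, map_oneCocycleClass,
    coresLe_oneCocycleClass Y h hH hs]
  refine congrArg _ (Subtype.ext (ContinuousMap.ext fun g => ?_))
  rw [contOneCocycles.pullback_apply, transferCocycle_apply, transferCocycle_apply]
  change ((TopRep.resFunctor H'.subtype).map f).hom
      (transferFun (subgroupRep X H') (H.subgroupOf H') hs _ g) = _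
  rw [← transferFun_pullback ((TopRep.resFunctor H'.subtype).map f) (H.subgroupOf H') hs]
  exact congrArg (fun ψ => transferFun (subgroupRep Y H') (H.subgroupOf H') hs ψ g)
    (Subtype.ext (ContinuousMap.ext fun _ => rfl))

end Coeff

/-! ### §2 The one-term double-coset formula: `res_D ∘ cor_{G/N} = cor_{D/D∩N} ∘ res` when `D·N = G` -/
section OneTerm

variable (X : TopRep.{v} R G) (N : Subgroup G) [Fintype (G ⧸ N)]
variable (D D' : Subgroup G) (hD'D : D' ≤ D) (hD'N : D' ≤ N) [Fintype (D ⧸ D'.subgroupOf D)]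

omit [TopologicalSpace G] [IsTopologicalGroup G] [Fintype (G ⧸ N)]
  [Fintype (D ⧸ D'.subgroupOf D)] in
include hD'N in
/-- If `D` meets every coset of `N` and `D ∩ N ≤ D′ ≤ D ∩ N`, a system of representatives `u` of
`D ⧸ D′` is a system of representatives of `G ⧸ N`: `δ ↦ u(δ) N` is a bijection
`D ⧸ D′ ≃ G ⧸ N`. [folklore] -/
theorem bijective_coe_rep (hDN : ∀ g : G, g ∈ D → g ∈ N → g ∈ D')
    (hsurj : ∀ g : G, ∃ d : D, (d : G)⁻¹ * g ∈ N)
    {u : D ⧸ D'.subgroupOf D → D} (hu : ∀ δ, (u δ : D ⧸ D'.subgroupOf D) = δ) :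
    Function.Bijective fun δ : D ⧸ D'.subgroupOf D => (((u δ : D) : G) : G ⧸ N) := by
  constructor
  · intro δ₁ δ₂ h
    have hN : ((u δ₁ : D) : G)⁻¹ * ((u δ₂ : D) : G) ∈ N := QuotientGroup.eq.mp h
    have hD' : ((u δ₁)⁻¹ * u δ₂ : D) ∈ D'.subgroupOf D := by
      rw [Subgroup.mem_subgroupOf, Subgroup.coe_mul, Subgroup.coe_inv]
      exact hDN _ ((u δ₁)⁻¹ * u δ₂).2 hN
    rw [← hu δ₁, ← hu δ₂]
    exact QuotientGroup.eq.mpr hD'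
  · intro y
    induction y using QuotientGroup.induction_on with
    | H g =>
      obtain ⟨d, hd⟩ := hsurj g
      refine ⟨(d : D ⧸ D'.subgroupOf D), ?_⟩
      have hm : (d⁻¹ * u (d : D ⧸ D'.subgroupOf D) : D) ∈ D'.subgroupOf D :=
        QuotientGroup.eq.mp (hu _).symm
      rw [Subgroup.mem_subgroupOf, Subgroup.coe_mul, Subgroup.coe_inv] at hm
      change ((((u (d : D ⧸ D'.subgroupOf D) : D) : G)) : G ⧸ N) = (g : G ⧸ N)
      rw [QuotientGroup.eq]
      have h1 : ((u (d : D ⧸ D'.subgroupOf D) : D) : G)⁻¹ * (d : G) ∈ N := by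
        have h2 := N.inv_mem (hD'N hm)
        rwa [mul_inv_rev, inv_inv] at h2
      have h3 := N.mul_mem h1 hd
      rwa [mul_assoc, mul_inv_cancel_left] at h3

/-- **One-term double-coset formula.**  Let `N ≤ G` be open of finite index, `D ≤ G` a subgroup
meeting every coset of `N` (`D · N = G`), and `D′` the subgroup `D ∩ N` (given as any `D′` with
`D′ ≤ D`, `D′ ≤ N`, `D ∩ N ≤ D′`, open in `D`).  Then on `H¹(N, X)`
`res_D ∘ cor_{G/N} = cor_{D/D′} ∘ res_{N/D′}`: computing the transfer with coset
representatives `u(δ) ∈ D` of `G/N = D N/N ≅ D/D′`, the Schreier elements `u(gδ)⁻¹ g u(δ)`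
(`g ∈ D`) lie in `D′` and the transfer of `φ` restricted to `D` IS the transfer of `φ|_{D′}`
from `D′` to `D`.  (NSW I §5 (1.5.6): the double coset `D \ G / N` is a single point.) For
`G = Γ_K`, `N = Gal(K̄/K_i)`, `D = Gal(K̄/K(r))` with `K_i ∩ K(r) = K` this reads
`res_{K(r)} ∘ Cor_{K_i/K} = Cor_{K_i(r)/K(r)} ∘ res_{K_i(r)}`.
[cite: NeukirchSchmidtWingberg2008, I §5 (1.5.6)–(1.5.7)] -/
theorem resSubgroup_cores_eq_cores_of_forall_exists (hDN : ∀ g : G, g ∈ D → g ∈ N → g ∈ D') (hN : IsOpen (N : Set G))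
    (hD'o : IsOpen ((D'.subgroupOf D : Subgroup D) : Set D))
    (hsurj : ∀ g : G, ∃ d : D, (d : G)⁻¹ * g ∈ N) (y : continuousCohomology 1 (subgroupRep X N)) :
    resSubgroup X D 1 (cores X N hN y) =
      cores (subgroupRep X D) (D'.subgroupOf D) hD'o (toSubgroupOf X hD'D 1 (resLe X hD'N 1 y)) := by
  classical
  obtain ⟨φ, rfl⟩ := oneCocycleClass_surjective _ y
  set u : D ⧸ D'.subgroupOf D → D := Quotient.out with hu_def
  have hu : ∀ δ, (u δ : D ⧸ D'.subgroupOf D) = δ := QuotientGroup.out_eq'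
  set e : D ⧸ D'.subgroupOf D ≃ G ⧸ N :=
    Equiv.ofBijective _ (bijective_coe_rep N D D' hD'N hDN hsurj hu) with he_def
  have he : ∀ δ, e δ = (((u δ : D) : G) : G ⧸ N) := fun δ => rfl
  -- representatives of `G ⧸ N` inside `D`
  set s : G ⧸ N → G := fun y => ((u (e.symm y) : D) : G) with hs_def
  have hse : ∀ δ, s (e δ) = ((u δ : D) : G) := fun δ => by
    simp only [hs_def, Equiv.symm_apply_apply]
  have hs : ∀ y, (s y : G ⧸ N) = y := fun y => by
    obtain ⟨δ, rfl⟩ := e.surjective y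
    rw [hse, he]
  -- `g • e δ = e (g • δ)` for `g ∈ D`
  have hsmul : ∀ (g : D) (δ : D ⧸ D'.subgroupOf D), (g : G) • e δ = e (g • δ) := fun g δ => by
    rw [he, he, MulAction.Quotient.smul_coe, QuotientGroup.eq, smul_eq_mul, mul_inv_rev, mul_assoc]
    have hmem := (schreierElt (D'.subgroupOf D) hu g δ).2
    rw [Subgroup.mem_subgroupOf, schreierElt_coe, Subgroup.coe_mul, Subgroup.coe_mul,
      Subgroup.coe_inv] at hmem
    have hN' := N.inv_mem (hD'N hmem)
    rwa [mul_inv_rev, mul_inv_rev, inv_inv] at hN'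
  rw [cores_oneCocycleClass X N hN hs, resSubgroup_oneCocycleClass, resLe_oneCocycleClass,
    toSubgroupOf, map_oneCocycleClass, cores_oneCocycleClass _ _ hD'o hu]
  refine congrArg _ (Subtype.ext (ContinuousMap.ext fun g => ?_))
  rw [resSubgroup_pullback_apply, transferCocycle_apply, transferCocycle_apply, transferFun_apply,
    transferFun_apply, ← e.sum_comp]
  refine Finset.sum_congr rfl fun δ _ => ?_
  rw [hsmul, hse, subgroupRep_ρ_apply, contOneCocycles.pullback_apply,
    contOneCocycles.pullback_apply]
  change X.ρ _ (φ.1 _) = X.ρ _ (φ.1 _)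
  congr 2
  apply Subtype.ext
  rw [schreierElt_coe, hsmul, hse, hse, subgroupInclusion_apply_coe, subgroupOfHom_apply_coe,
    schreierElt_coe, Subgroup.coe_mul, Subgroup.coe_mul, Subgroup.coe_inv]

/-- The same in `coresLe` currency when `D′` is open in `G` (e.g. `D′ = D ∩ N` with `D` open):
`res_D ∘ cor_{G/N} = coresLe_{D′ ≤ D} ∘ resLe_{D′ ≤ N}`. [folklore] -/
theorem resSubgroup_cores_eq_coresLe_of_forall_exists (hDN : ∀ g : G, g ∈ D → g ∈ N → g ∈ D') (hN : IsOpen (N : Set G))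
    (hD'open : IsOpen (D' : Set G))
    (hsurj : ∀ g : G, ∃ d : D, (d : G)⁻¹ * g ∈ N) (y : continuousCohomology 1 (subgroupRep X N)) :
    resSubgroup X D 1 (cores X N hN y) = coresLe X hD'D hD'open (resLe X hD'N 1 y) := by
  rw [resSubgroup_cores_eq_cores_of_forall_exists X N D D' hD'D hD'N hDN hN
    (isOpen_subgroupOf D hD'open) hsurj y, coresLe, LinearMap.comp_apply]
  rfl

end OneTerm

/-! ### §3 The double-coset (Mackey) formula for a normal open `N` and any subgroup `D` -/
section Mackey

variable (X : TopRep.{v} R G) (N : Subgroup G) [N.Normal] [Fintype (G ⧸ N)]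
variable (D D' : Subgroup G) (hD'D : D' ≤ D) (hD'N : D' ≤ N) [Fintype (D ⧸ D'.subgroupOf D)]
  [Fintype (G ⧸ (D ⊔ N))]

omit [TopologicalSpace G] [IsTopologicalGroup G] [Fintype (G ⧸ N)]
  [Fintype (D ⧸ D'.subgroupOf D)] [Fintype (G ⧸ (D ⊔ N))] in
include hD'N in
/-- **The `D`-orbits on `G ⧸ N`.**  For `N ⊴ G`, a subgroup `D`, `D′ = D ∩ N` (any `D′ ≤ D`,
`D′ ≤ N` with `D ∩ N ≤ D′`), representatives `t_q` of `G ⧸ (D ⊔ N)` and `u_δ` of `D ⧸ D′`, the map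
`(q, δ) ↦ u_δ t_q⁻¹ N` is a bijection `(G ⧸ D N) × (D ⧸ D′) ≃ G ⧸ N`: the `D`-orbit of `g N` is
`D g N / N = D N g / N ≅ D ⧸ D′`, and the orbits are indexed by the cosets of `D N`. [folklore] -/
theorem bijective_coe_rep_mul_inv (hDN : ∀ g : G, g ∈ D → g ∈ N → g ∈ D')
    {t : G ⧸ (D ⊔ N) → G} (ht : ∀ q, (t q : G ⧸ (D ⊔ N)) = q)
    {u : D ⧸ D'.subgroupOf D → D} (hu : ∀ δ, (u δ : D ⧸ D'.subgroupOf D) = δ) :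
    Function.Bijective fun p : (G ⧸ (D ⊔ N)) × (D ⧸ D'.subgroupOf D) =>
      ((((u p.2 : D) : G) * (t p.1)⁻¹ : G) : G ⧸ N) := by
  constructor
  · rintro ⟨q₁, δ₁⟩ ⟨q₂, δ₂⟩ h
    have hn : t q₁ * (((u δ₁ : D) : G)⁻¹ * ((u δ₂ : D) : G)) * (t q₂)⁻¹ ∈ N := by
      have h' := QuotientGroup.eq.mp h
      rwa [mul_inv_rev, inv_inv, ← mul_assoc, mul_assoc (t q₁)] at h'
    -- the two orbits agree
    have hq : q₁ = q₂ := by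
      rw [← ht q₁, ← ht q₂, QuotientGroup.eq]
      have hconj : (t q₁)⁻¹ * (t q₁ * (((u δ₁ : D) : G)⁻¹ * ((u δ₂ : D) : G)) * (t q₂)⁻¹)⁻¹ * t q₁ ∈ N :=
        conj_mem_of_normal N (t q₁) ⟨_, N.inv_mem hn⟩
      have hD : ((u δ₁ : D) : G)⁻¹ * ((u δ₂ : D) : G) ∈ D := D.mul_mem (D.inv_mem (u δ₁).2) (u δ₂).2
      have hprod := (D ⊔ N).mul_mem (Subgroup.mem_sup_right hconj) (Subgroup.mem_sup_left hD)
      have e : (t q₁)⁻¹ * (t q₁ * (((u δ₁ : D) : G)⁻¹ * ((u δ₂ : D) : G)) * (t q₂)⁻¹)⁻¹ * t q₁ *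
          (((u δ₁ : D) : G)⁻¹ * ((u δ₂ : D) : G)) = (t q₁)⁻¹ * t q₂ := by group
      rwa [e] at hprod
    subst hq
    -- then the two points of the orbit agree
    have hN' : ((u δ₁ : D) : G)⁻¹ * ((u δ₂ : D) : G) ∈ N := by
      have h' := conj_mem_of_normal N (t q₁) ⟨_, hn⟩
      have e : (t q₁)⁻¹ * (t q₁ * (((u δ₁ : D) : G)⁻¹ * ((u δ₂ : D) : G)) * (t q₁)⁻¹) * t q₁ =
          ((u δ₁ : D) : G)⁻¹ * ((u δ₂ : D) : G) := by group
      rwa [e] at h'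
    have hD' : ((u δ₁)⁻¹ * u δ₂ : D) ∈ D'.subgroupOf D := by
      rw [Subgroup.mem_subgroupOf, Subgroup.coe_mul, Subgroup.coe_inv]
      exact hDN _ ((u δ₁)⁻¹ * u δ₂).2 hN'
    have hδ : δ₁ = δ₂ := by
      rw [← hu δ₁, ← hu δ₂]
      exact QuotientGroup.eq.mpr hD'
    rw [hδ]
  · intro y
    induction y using QuotientGroup.induction_on with
    | H g =>
      set q : G ⧸ (D ⊔ N) := ((g⁻¹ : G) : G ⧸ (D ⊔ N)) with hq_def
      -- `g t_q ∈ D N`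
      have hmem : g * t q ∈ D ⊔ N := by
        have h' := QuotientGroup.eq.mp (ht q).symm
        rwa [inv_inv] at h'
      have hset : g * t q ∈ ((D ⊔ N : Subgroup G) : Set G) := hmem
      rw [Subgroup.mul_normal] at hset
      obtain ⟨d, hd, n, hn, hdn⟩ := Set.mem_mul.mp hset
      refine ⟨(q, ((⟨d, hd⟩ : D) : D ⧸ D'.subgroupOf D)), ?_⟩
      -- `u δ = d m`, `m ∈ D′ ≤ N`
      have hm : ((u ((⟨d, hd⟩ : D) : D ⧸ D'.subgroupOf D) : D) : G)⁻¹ * d ∈ N := by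
        have h' : ((u ((⟨d, hd⟩ : D) : D ⧸ D'.subgroupOf D))⁻¹ * ⟨d, hd⟩ : D) ∈ D'.subgroupOf D :=
          QuotientGroup.eq.mp (hu _)
        rw [Subgroup.mem_subgroupOf, Subgroup.coe_mul, Subgroup.coe_inv] at h'
        exact hD'N h'
      change ((((u ((⟨d, hd⟩ : D) : D ⧸ D'.subgroupOf D) : D) : G) * (t q)⁻¹ : G) : G ⧸ N) =
        (g : G ⧸ N)
      rw [QuotientGroup.eq, eq_mul_inv_of_mul_eq hdn.symm]
      have hin : ((u ((⟨d, hd⟩ : D) : D ⧸ D'.subgroupOf D) : D) : G)⁻¹ * d * n ∈ N := N.mul_mem hm hn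
      have hconj := ‹N.Normal›.conj_mem _ hin (t q)
      have e : t q * (((u ((⟨d, hd⟩ : D) : D ⧸ D'.subgroupOf D) : D) : G)⁻¹ * d * n) * (t q)⁻¹ =
          (((u ((⟨d, hd⟩ : D) : D ⧸ D'.subgroupOf D) : D) : G) * (t q)⁻¹)⁻¹ * (d * n * (t q)⁻¹) := by
        group
      rwa [e] at hconj

/-- **The double-coset (Mackey) formula for corestriction followed by restriction**, for an open
normal subgroup `N` of finite index and ANY subgroup `D` (with `D′ = D ∩ N` as in §2,
representatives `t_q` of `G ⧸ D N`):
`res_D (cor_{G/N} y) = Σ_{q ∈ G/DN} cor_{D/D′} (res_{N/D′} ((t_q)⁻¹ · y))` on `H¹(N, X)`, where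
`g · y` is the action `conjMap` of `g ∈ G` on `H¹(N, X)` (`(g·φ)(n) = g φ(g⁻¹ n g)`).  Proof on
cocycles: with the representatives `u_δ t_q⁻¹` of `G ⧸ N` adapted to the `D`-orbits
(`bijective_coe_rep_mul_inv`), the Schreier element of `g ∈ D` at `u_δ t_q⁻¹ N` is
`t_q (u_{gδ}⁻¹ g u_δ) t_q⁻¹`, so the `q`-th partial sum of the transfer is the transfer of `D`
along `D′` applied to the cocycle `n ↦ t_q⁻¹ φ(t_q n t_q⁻¹)`.  The case `D = N` is the tree's
`resSubgroup_cores_eq_sum` (`res ∘ cor = Σ_{G/N} conj`).  (Brown, *Cohomology of Groups*,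
III (9.5) (ii); NSW (2008) I §5.) [cite: NeukirchSchmidtWingberg2008, I §5 (1.5.6)–(1.5.7)] -/
theorem resSubgroup_cores_eq_sum_cores (hDN : ∀ g : G, g ∈ D → g ∈ N → g ∈ D')
    (hN : IsOpen (N : Set G)) (hD'o : IsOpen ((D'.subgroupOf D : Subgroup D) : Set D))
    {t : G ⧸ (D ⊔ N) → G} (ht : ∀ q, (t q : G ⧸ (D ⊔ N)) = q)
    (y : continuousCohomology 1 (subgroupRep X N)) :
    resSubgroup X D 1 (cores X N hN y) =
      ∑ q : G ⧸ (D ⊔ N), cores (subgroupRep X D) (D'.subgroupOf D) hD'o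
        (toSubgroupOf X hD'D 1 (resLe X hD'N 1 (conjMap X N (t q)⁻¹ 1 y))) := by
  classical
  obtain ⟨φ, rfl⟩ := oneCocycleClass_surjective _ y
  set u : D ⧸ D'.subgroupOf D → D := Quotient.out with hu_def
  have hu : ∀ δ, (u δ : D ⧸ D'.subgroupOf D) = δ := QuotientGroup.out_eq'
  set e : (G ⧸ (D ⊔ N)) × (D ⧸ D'.subgroupOf D) ≃ G ⧸ N :=
    Equiv.ofBijective _ (bijective_coe_rep_mul_inv N D D' hD'N hDN ht hu) with he_def
  have he : ∀ p, e p = ((((u p.2 : D) : G) * (t p.1)⁻¹ : G) : G ⧸ N) := fun p => rfl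
  -- representatives of `G ⧸ N` adapted to the `D`-orbits
  set s : G ⧸ N → G := fun y => ((u (e.symm y).2 : D) : G) * (t (e.symm y).1)⁻¹ with hs_def
  have hse : ∀ p, s (e p) = ((u p.2 : D) : G) * (t p.1)⁻¹ := fun p => by
    simp only [hs_def, Equiv.symm_apply_apply]
  have hs : ∀ y, (s y : G ⧸ N) = y := fun y => by
    obtain ⟨p, rfl⟩ := e.surjective y
    rw [hse, he]
  -- `g • e (q, δ) = e (q, g • δ)` for `g ∈ D`
  have hsmul : ∀ (g : D) (q : G ⧸ (D ⊔ N)) (δ : D ⧸ D'.subgroupOf D),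
      (g : G) • e (q, δ) = e (q, g • δ) := fun g q δ => by
    rw [he, he, MulAction.Quotient.smul_coe, QuotientGroup.eq, smul_eq_mul]
    have hmem := (schreierElt (D'.subgroupOf D) hu g δ).2
    rw [Subgroup.mem_subgroupOf, schreierElt_coe, Subgroup.coe_mul, Subgroup.coe_mul,
      Subgroup.coe_inv] at hmem
    have hN' := ‹N.Normal›.conj_mem _ (N.inv_mem (hD'N hmem)) (t q)
    have e' : t q * (((u (g • δ) : D) : G)⁻¹ * (g : G) * ((u δ : D) : G))⁻¹ * (t q)⁻¹ =
        ((g : G) * (((u δ : D) : G) * (t q)⁻¹))⁻¹ * (((u (g • δ) : D) : G) * (t q)⁻¹) := by group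
    rwa [e'] at hN'
  -- both sides as classes of explicit cocycles
  rw [cores_oneCocycleClass X N hN hs, resSubgroup_oneCocycleClass]
  simp only [conjMap_oneCocycleClass, resLe_oneCocycleClass, toSubgroupOf, map_oneCocycleClass,
    cores_oneCocycleClass _ _ hD'o hu]
  simp only [← oneCocycleClassₗ_apply]
  rw [← map_sum]
  simp only [oneCocycleClassₗ_apply]
  refine congrArg _ (Subtype.ext (ContinuousMap.ext fun g => ?_))
  rw [resSubgroup_pullback_apply, transferCocycle_apply, transferFun_apply, ← e.sum_comp,
    Fintype.sum_prod_type, sum_apply_val']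
  refine Finset.sum_congr rfl fun q _ => ?_
  rw [transferCocycle_apply, transferFun_apply]
  refine Finset.sum_congr rfl fun δ _ => ?_
  rw [hsmul, hse, ρ_mul_apply, subgroupRep_ρ_apply, contOneCocycles.pullback_apply,
    contOneCocycles.pullback_apply, conj_pullback_apply]
  change X.ρ _ (X.ρ _ (φ.1 _)) = X.ρ _ (X.ρ _ (φ.1 _))
  congr 3
  apply Subtype.ext
  rw [schreierElt_coe, hsmul, hse, hse, subgroupConj_apply_coe, subgroupInclusion_apply_coe,
    subgroupOfHom_apply_coe, schreierElt_coe, Subgroup.coe_mul, Subgroup.coe_mul, Subgroup.coe_inv]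
  dsimp only
  group

end Mackey

end Mackey

end Derivative

end Summit.BirchSwinnertonDyer.Rank1Residual.GaloisImage

end
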